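import Summits.QuantumFields.BalabanUV.Beta.D1BFx.RColumnBlockMass

/-!
# `BalabanUV.Beta.D1BFx.NeedlePotentialLetters` — road «BF-x» for binder row D1, slot (K), END row `hGrp gN`, «GN-L3» PART 2c (owner ruling ρ-g9-33 (L3)
# «NEEDLE-POTENTIAL PROFILE for `row_u` — the ONE NEW letter (masses = an3's tables' `w`)»): THE FINE-`ℓ¹` MASSES `m_ρ`, `m_{δρ}`, `m′_ρ` OF THE R-COLUMN AND
# THE MASS ∕ SUP LETTERS OF THE NEEDLE POTENTIAL `ndlRow n a κ′ u x = Σ_{s∈B(blk u)} RG(x,s)·qJet n κ′ u (blk u) s` WITH THE NEEDLE WEIGHT `w = n^{κ′+1}·n⁻⁴`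

HONEST DEPENDENCY (cell records, verbatim): «continuum YM on T⁴ ⇐ BetaPertH ∧ nine spine estimates (0/9 proved); BetaPertH ⇐ (D1) ∧ (D4) ∧
CAP+tail; G-an2-4 gates asym, D1 and NE2/3/4.»  HONEST FRAMING (cell contract, verbatim): «discharging `BetaPertH` makes Bałaban's UV stability
UNCONDITIONAL — a real constructive-QFT result; it is NOT the continuum limit and NOT the Clay problem.»  THIS MODULE DISCHARGES NOTHING of the wall:
[folklore] bookkeeping over PART 2b `RColumnBlockMass` (block masses of `RG` and of its differences, n-free, block decay) and the needle weight
`AveragingJetNeedle.sum_B_abs_qJet_le` (`Σ_{s∈B}|qJet| ≤ n^{κ′+1}·n⁻⁴`) ∕ `abs_qJet_le_inv_pow_four` (`|qJet| ≤ n⁻⁴`); ONE definition (`ndlRow`, a name for the finite sum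
that `CornerVBlockRank.cornerV_qAnti_apply_road` and `NeedleRowLetters.abs_needleRow_road_le` write inline — it asserts nothing); no `def … : Prop`, no hypothesis
is a printed statement, 0 binders of row D1 touched; (K) NOT closed; NOT (CONV-C), NOT D1, NOT BetaPertH, NOT continuum, NOT Clay.

WHY (an3-g57 `N36-SPLIT.v1.md` §3′ (2) «NEEDLE POTENTIAL `row_u` (NEW — the T₃ letter …): `m_row(u) ≤ w_u·m_ρ`, `m′_row(u) ≤ w_u·m′_ρ`, profile …
for λ = 3 this is M10 × n⁻⁴ verbatim» and (6) «AT κ = 3 NO PROFILE IS EVEN NEEDED: `|row_u| ≤ k·n⁻⁴` and `|∇row_u| ≤ k·n⁻⁵` UNIFORMLY …, masses `m_row ≤ kK`,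
`m′_row ≤ kK∕n`»; owner ρ-g9-33: «a row filed on a sup letter will be ruled «letter uninhabited»» — the tree's `NeedleRowLetters.abs_needleRow_road_le`
(`k·n^{κ′−3}` SUP over the n-free sup `abs_RG_road_le`) is `n⁴` above the envelope).  Here every letter is read off the MASS letters of PART 2b, so the
values ARE those of the `R∘G′` envelope: sup `|ndlRow| ≤ n⁻⁴·cR·e^{−dR·dist(blk x, blk u)}` (for κ′ = 3 exactly an3's «M10 × n⁻⁴», now with block decay),
`|∇ndlRow| ≤ n⁻⁴·(cRd∕n)·e^{…}`, block masses `Σ_{x∈B(β)}|ndlRow| ≤ w·cR·e^{−dR·dist(β, blk u)}`, `Σ_{x∈B(β)}|∇ndlRow| ≤ w·(cRd∕n)·e^{…}`, fine masses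
`m_row ≤ w·cR·K₄(dR)`, `m′_row ≤ w·(cRd∕n)·K₄(dR)` with the needle weight **`w = n^{κ′+1}·n⁻⁴`** (`≥ #𝒩_u∕n⁴ = w_u` of an3's tables; `= 1` at κ′ = 3).

CONTENT ([folklore]; `B = B (n−1)`, `blk = blk (n−1)`, `K₄ = latticeConst 4`, constants `dR`, `cR`, `cRd` of PART 2b; `[NeZero n]`, `0 < a`):
* §1 fine masses of the R-column: **`tsum_abs_RG_col_le`** (`m_ρ ≤ cR·K₄(dR)`), **`tsum_abs_RG_col_diff_le`** (`m_{δρ} ≤ (cRd∕n)·K₄(dR)`),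
  **`tsum_abs_RG_diff_col_le`** (`m′_ρ ≤ (cRd∕n)·K₄(dR)`).
* §2 [our object] **`ndlRow`**; sup letters **`abs_ndlRow_le`**, **`abs_ndlRow_diff_le`**; block masses **`sum_B_abs_ndlRow_le`**, **`sum_B_abs_ndlRow_diff_le`**;
  fine masses **`tsum_abs_ndlRow_le`**, **`tsum_abs_ndlRow_diff_le`** (with `summable_abs_ndlRow`, `summable_abs_ndlRow_diff`).
NOT HERE: the thin-needle PROFILE `Φ_u(x) = Σ_{x′}|∇Ga(x,x′)|·|row_u(x′)|` (κ′ ≤ 2; needs the vector leg's d1 row, h12∕h126 class) and the HLS kit (L5); any END row.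
Unit `b2b-balaban-gan24-formalise-leaf-05` (gen 41), G-an2-4 swarm leaf prover on cross-lane kernel duty; `LEAVES-BFx.md` row (N) «GN-L3» PART 2c.
-/

namespace Summit.QuantumFields.BalabanUV.Beta.D1BFx.NeedlePotentialLetters

open Finset
open scoped BigOperators
open Literature.MathematicalPhysics.QuantumFieldTheory.Balaban1983to89
open Literature.MathematicalPhysics.QuantumFieldTheory.Balaban1983to89.Beta
open B4Sect5Proof (latticeConst latticeConst_nonneg)
open B6QGQLower276 (X blk B mem_B)
open AffineAveraging (unitVec)
open Summit.QuantumFields.BalabanUV.Beta.D1BFx.RProjector (Pgt abs_tsum_le_latticeConst)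
open Summit.QuantumFields.BalabanUV.Beta.D1BFx.GhostLeg (Ggh)
open Summit.QuantumFields.BalabanUV.Beta.D1BFx.GhostStencil (qJet)
open Summit.QuantumFields.BalabanUV.Beta.D1BFx.AveragingJetNeedle (sum_B_abs_qJet_le abs_qJet_le_inv_pow_four)
open Summit.QuantumFields.BalabanUV.Beta.D1BFx.RProjectorJet (RG)
open Summit.QuantumFields.BalabanUV.Beta.D1BFx.NeedleRowLetters (tsum_eq_tsum_blocks)
open Summit.QuantumFields.BalabanUV.Beta.D1BFx.RColumnBlockMass (dR cR cRd dR_pos cR_nonneg cRd_nonneg summable_abs_RG_col summable_abs_RG_col_diff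
  summable_abs_RG_diff_col sum_B_abs_RG_col_le sum_B_abs_RG_col_diff_le sum_B_abs_RG_diff_col_le sum_B_abs_RG_row_le sum_B_abs_RG_diff_row_le)

noncomputable section

variable (n : ℕ) [NeZero n] {a : ℝ}

/-! ## §1 The fine `ℓ¹` masses `m_ρ`, `m_{δρ}`, `m′_ρ` of the R-column -/

/-- [folklore] **`m_ρ ≤ cR a·K₄(dR a)`**: `Σ'_x |RG(x,s)| ≤ cR a · latticeConst 4 (dR a)` — n-FREE (an3 §3′ (2) «`m_ρ = O(1)` (M10)»). -/
theorem tsum_abs_RG_col_le (ha : 0 < a) (s : X 4) :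
    ∑' x : X 4, |RG (Ggh n a) (Pgt n a) x s () ()| ≤ cR a * latticeConst 4 (dR a) := by
  rw [tsum_eq_tsum_blocks (n - 1) (summable_abs_RG_col n ha s)]
  refine (le_abs_self _).trans (abs_tsum_le_latticeConst (dR_pos ha) (cR_nonneg ha) (blk (n - 1) s) fun β => ?_)
  rw [abs_of_nonneg (Finset.sum_nonneg fun x _ => abs_nonneg _), dist_comm]
  exact sum_B_abs_RG_col_le n ha s β

/-- [folklore] **`m_{δρ} ≤ (cRd a∕n)·K₄(dR a)`**: `Σ'_x |RG(x,s+e_ρ) − RG(x,s)| ≤ cRd a∕n · latticeConst 4 (dR a)` (an3 §3′ (2) «`m_{δρ} = O(n⁻¹)`»). -/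
theorem tsum_abs_RG_col_diff_le (ha : 0 < a) (s : X 4) (ρ : Fin 4) :
    ∑' x : X 4, |RG (Ggh n a) (Pgt n a) x (s + unitVec ρ) () () - RG (Ggh n a) (Pgt n a) x s () ()| ≤ cRd a / n * latticeConst 4 (dR a) := by
  have hn : (0 : ℝ) < n := Nat.cast_pos.mpr (Nat.pos_of_ne_zero (NeZero.ne n))
  rw [tsum_eq_tsum_blocks (n - 1) (summable_abs_RG_col_diff n ha s ρ)]
  refine (le_abs_self _).trans (abs_tsum_le_latticeConst (dR_pos ha) (div_nonneg (cRd_nonneg ha) hn.le) (blk (n - 1) s) fun β => ?_)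
  rw [abs_of_nonneg (Finset.sum_nonneg fun x _ => abs_nonneg _), dist_comm]
  exact sum_B_abs_RG_col_diff_le n ha s β ρ

/-- [folklore] **`m′_ρ ≤ (cRd a∕n)·K₄(dR a)`**: `Σ'_x |RG(x+e_ρ,s) − RG(x,s)| ≤ cRd a∕n · latticeConst 4 (dR a)` (an3 §3′ (2) «`m′_ρ = O(n⁻¹)`»). -/
theorem tsum_abs_RG_diff_col_le (ha : 0 < a) (s : X 4) (ρ : Fin 4) :
    ∑' x : X 4, |RG (Ggh n a) (Pgt n a) (x + unitVec ρ) s () () - RG (Ggh n a) (Pgt n a) x s () ()| ≤ cRd a / n * latticeConst 4 (dR a) := by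
  have hn : (0 : ℝ) < n := Nat.cast_pos.mpr (Nat.pos_of_ne_zero (NeZero.ne n))
  rw [tsum_eq_tsum_blocks (n - 1) (summable_abs_RG_diff_col n ha s ρ)]
  refine (le_abs_self _).trans (abs_tsum_le_latticeConst (dR_pos ha) (div_nonneg (cRd_nonneg ha) hn.le) (blk (n - 1) s) fun β => ?_)
  rw [abs_of_nonneg (Finset.sum_nonneg fun x _ => abs_nonneg _), dist_comm]
  exact sum_B_abs_RG_diff_col_le n ha s β ρ

/-! ## §2 The needle potential -/

/-- [our object] **THE NEEDLE POTENTIAL** of the bond `⟨u, u+e_κ′⟩`: `ndlRow n a κ′ u x := Σ_{s ∈ B(blk u)} RG (Ggh n a) (Pgt n a) x s · qJet n κ′ u (blk u) s` — the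
row of `R∘G′` against the averaging jet supported on the needle box of the bond (the finite sum written inline in `CornerVBlockRank.cornerV_qAnti_apply_road`
and `NeedleRowLetters.abs_needleRow_road_le`).  A definition; asserts nothing. -/
def ndlRow (a : ℝ) (κ' : Fin 4) (u x : X 4) : ℝ :=
  ∑ s ∈ B (n - 1) (blk (n - 1) u), RG (Ggh n a) (Pgt n a) x s () () * qJet n κ' u (blk (n - 1) u) s

variable (κ' : Fin 4) (u : X 4)

/-- [our object] Unfolding. -/
theorem ndlRow_def (x : X 4) :
    ndlRow n a κ' u x = ∑ s ∈ B (n - 1) (blk (n - 1) u), RG (Ggh n a) (Pgt n a) x s () () * qJet n κ' u (blk (n - 1) u) s := rfl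

/-- [folklore] The first difference of the needle potential is the needle average of the first difference of the R-rows. -/
theorem ndlRow_diff_eq (x y : X 4) :
    ndlRow n a κ' u y - ndlRow n a κ' u x
      = ∑ s ∈ B (n - 1) (blk (n - 1) u), (RG (Ggh n a) (Pgt n a) y s () () - RG (Ggh n a) (Pgt n a) x s () ()) * qJet n κ' u (blk (n - 1) u) s := by
  rw [ndlRow, ndlRow, ← Finset.sum_sub_distrib]
  exact Finset.sum_congr rfl fun s _ => (sub_mul _ _ _).symm

/-- [folklore] The pointwise step: `|Σ_{s∈B(blk u)} A s·qJet s| ≤ n⁻⁴·Σ_{s∈B(blk u)} |A s|` (`abs_qJet_le_inv_pow_four`). -/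
theorem abs_sum_mul_qJet_le (A : X 4 → ℝ) :
    |∑ s ∈ B (n - 1) (blk (n - 1) u), A s * qJet n κ' u (blk (n - 1) u) s| ≤ ((n : ℝ) ^ 4)⁻¹ * ∑ s ∈ B (n - 1) (blk (n - 1) u), |A s| := by
  calc |∑ s ∈ B (n - 1) (blk (n - 1) u), A s * qJet n κ' u (blk (n - 1) u) s|
      ≤ ∑ s ∈ B (n - 1) (blk (n - 1) u), |A s * qJet n κ' u (blk (n - 1) u) s| := Finset.abs_sum_le_sum_abs _ _
    _ ≤ ∑ s ∈ B (n - 1) (blk (n - 1) u), |A s| * ((n : ℝ) ^ 4)⁻¹ := Finset.sum_le_sum fun s _ => by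
        rw [abs_mul]; exact mul_le_mul_of_nonneg_left (abs_qJet_le_inv_pow_four n κ' u _ s) (abs_nonneg _)
    _ = ((n : ℝ) ^ 4)⁻¹ * ∑ s ∈ B (n - 1) (blk (n - 1) u), |A s| := by rw [← Finset.sum_mul, mul_comm]

/-- [folklore] The block step: `Σ_{x∈S} |Σ_{s∈B(blk u)} A x s·qJet s| ≤ (n^{κ′+1}·n⁻⁴)·M` whenever every column `Σ_{x∈S}|A x s|` (`s ∈ B(blk u)`) is `≤ M`
(`Finset.sum_comm` + `sum_B_abs_qJet_le`). -/
theorem sum_abs_sum_mul_qJet_le (S : Finset (X 4)) (A : X 4 → X 4 → ℝ) {M : ℝ} (hM0 : 0 ≤ M)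
    (hM : ∀ s ∈ B (n - 1) (blk (n - 1) u), ∑ x ∈ S, |A x s| ≤ M) :
    ∑ x ∈ S, |∑ s ∈ B (n - 1) (blk (n - 1) u), A x s * qJet n κ' u (blk (n - 1) u) s| ≤ ((n : ℝ) ^ ((κ' : ℕ) + 1) * ((n : ℝ) ^ 4)⁻¹) * M := by
  calc ∑ x ∈ S, |∑ s ∈ B (n - 1) (blk (n - 1) u), A x s * qJet n κ' u (blk (n - 1) u) s|
      ≤ ∑ x ∈ S, ∑ s ∈ B (n - 1) (blk (n - 1) u), |A x s| * |qJet n κ' u (blk (n - 1) u) s| :=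
        Finset.sum_le_sum fun x _ => (Finset.abs_sum_le_sum_abs _ _).trans (le_of_eq (Finset.sum_congr rfl fun s _ => abs_mul _ _))
    _ = ∑ s ∈ B (n - 1) (blk (n - 1) u), (∑ x ∈ S, |A x s|) * |qJet n κ' u (blk (n - 1) u) s| := by
        rw [Finset.sum_comm]; exact Finset.sum_congr rfl fun s _ => (Finset.sum_mul _ _ _).symm
    _ ≤ ∑ s ∈ B (n - 1) (blk (n - 1) u), M * |qJet n κ' u (blk (n - 1) u) s| :=
        Finset.sum_le_sum fun s hs => mul_le_mul_of_nonneg_right (hM s hs) (abs_nonneg _)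
    _ = M * ∑ s ∈ B (n - 1) (blk (n - 1) u), |qJet n κ' u (blk (n - 1) u) s| := by rw [Finset.mul_sum]
    _ ≤ M * ((n : ℝ) ^ ((κ' : ℕ) + 1) * ((n : ℝ) ^ 4)⁻¹) := mul_le_mul_of_nonneg_left (sum_B_abs_qJet_le n κ' u _) hM0
    _ = ((n : ℝ) ^ ((κ' : ℕ) + 1) * ((n : ℝ) ^ 4)⁻¹) * M := mul_comm _ _

/-- [folklore] **THE SUP LETTER WITH BLOCK DECAY** (an3 §3′ (6) at κ′ = 3: «`|row_u| ≤ k·n⁻⁴` … M10 × `qJet ≤ n⁻⁴` verbatim»; valid for every κ′ as an upper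
envelope): `|ndlRow n a κ′ u x| ≤ n⁻⁴ · cR a · e^{−dR a·dist(blk x, blk u)}`. -/
theorem abs_ndlRow_le (ha : 0 < a) (x : X 4) :
    |ndlRow n a κ' u x| ≤ ((n : ℝ) ^ 4)⁻¹ * (cR a * Real.exp (-(dR a * dist (blk (n - 1) x) (blk (n - 1) u)))) := by
  rw [ndlRow_def]
  exact (abs_sum_mul_qJet_le n κ' u _).trans
    (mul_le_mul_of_nonneg_left (sum_B_abs_RG_row_le n ha x (blk (n - 1) u)) (inv_nonneg.2 (pow_nonneg (Nat.cast_nonneg n) 4)))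

/-- [folklore] **THE d1 SUP LETTER** (an3 §3′ (6): «`|∇row_u| ≤ k·n⁻⁵`»): `|ndlRow (x+e_ρ) − ndlRow x| ≤ n⁻⁴ · (cRd a∕n) · e^{−dR a·dist(blk x, blk u)}`. -/
theorem abs_ndlRow_diff_le (ha : 0 < a) (x : X 4) (ρ : Fin 4) :
    |ndlRow n a κ' u (x + unitVec ρ) - ndlRow n a κ' u x|
      ≤ ((n : ℝ) ^ 4)⁻¹ * (cRd a / n * Real.exp (-(dR a * dist (blk (n - 1) x) (blk (n - 1) u)))) := by
  rw [ndlRow_diff_eq]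
  exact (abs_sum_mul_qJet_le n κ' u _).trans
    (mul_le_mul_of_nonneg_left (sum_B_abs_RG_diff_row_le n ha x (blk (n - 1) u) ρ) (inv_nonneg.2 (pow_nonneg (Nat.cast_nonneg n) 4)))

/-- [folklore] **THE BLOCK MASS OF THE NEEDLE POTENTIAL** (an3 §3′ (2) «`m_row(u) ≤ w_u·m_ρ`», block form):
`Σ_{x ∈ B(β)} |ndlRow n a κ′ u x| ≤ (n^{κ′+1}·n⁻⁴) · cR a · e^{−dR a·dist(β, blk u)}`. -/
theorem sum_B_abs_ndlRow_le (ha : 0 < a) (β : X 4) :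
    ∑ x ∈ B (n - 1) β, |ndlRow n a κ' u x|
      ≤ ((n : ℝ) ^ ((κ' : ℕ) + 1) * ((n : ℝ) ^ 4)⁻¹) * (cR a * Real.exp (-(dR a * dist β (blk (n - 1) u)))) := by
  simp only [ndlRow_def]
  refine sum_abs_sum_mul_qJet_le n κ' u (B (n - 1) β) (fun x s => RG (Ggh n a) (Pgt n a) x s () ())
    (mul_nonneg (cR_nonneg ha) (Real.exp_pos _).le) fun s hs => ?_
  have h := sum_B_abs_RG_col_le n ha s β
  rwa [mem_B.1 hs] at h

/-- [folklore] **THE BLOCK MASS OF THE FIRST DIFFERENCE OF THE NEEDLE POTENTIAL** (an3 §3′ (2) «`m′_row(u) ≤ w_u·m′_ρ`», block form):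
`Σ_{x ∈ B(β)} |ndlRow (x+e_ρ) − ndlRow x| ≤ (n^{κ′+1}·n⁻⁴) · (cRd a∕n) · e^{−dR a·dist(β, blk u)}`. -/
theorem sum_B_abs_ndlRow_diff_le (ha : 0 < a) (β : X 4) (ρ : Fin 4) :
    ∑ x ∈ B (n - 1) β, |ndlRow n a κ' u (x + unitVec ρ) - ndlRow n a κ' u x|
      ≤ ((n : ℝ) ^ ((κ' : ℕ) + 1) * ((n : ℝ) ^ 4)⁻¹) * (cRd a / n * Real.exp (-(dR a * dist β (blk (n - 1) u)))) := by
  have hn : (0 : ℝ) < n := Nat.cast_pos.mpr (Nat.pos_of_ne_zero (NeZero.ne n))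
  rw [show ∑ x ∈ B (n - 1) β, |ndlRow n a κ' u (x + unitVec ρ) - ndlRow n a κ' u x|
      = ∑ x ∈ B (n - 1) β, |∑ s ∈ B (n - 1) (blk (n - 1) u),
          (RG (Ggh n a) (Pgt n a) (x + unitVec ρ) s () () - RG (Ggh n a) (Pgt n a) x s () ()) * qJet n κ' u (blk (n - 1) u) s|
      from Finset.sum_congr rfl fun x _ => by rw [ndlRow_diff_eq]]
  refine sum_abs_sum_mul_qJet_le n κ' u (B (n - 1) β) (fun x s => RG (Ggh n a) (Pgt n a) (x + unitVec ρ) s () () - RG (Ggh n a) (Pgt n a) x s () ())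
    (mul_nonneg (div_nonneg (cRd_nonneg ha) hn.le) (Real.exp_pos _).le) fun s hs => ?_
  have h := sum_B_abs_RG_diff_col_le n ha s β ρ
  rwa [mem_B.1 hs] at h

/-- [folklore] `x ↦ |ndlRow x|` is summable over `ℤ⁴`. -/
theorem summable_abs_ndlRow (ha : 0 < a) : Summable fun x : X 4 => |ndlRow n a κ' u x| := by
  refine Summable.of_nonneg_of_le (fun _ => abs_nonneg _) (fun x => ?_)
    (summable_sum fun s (_ : s ∈ B (n - 1) (blk (n - 1) u)) => (summable_abs_RG_col n ha s).mul_right |qJet n κ' u (blk (n - 1) u) s|)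
  rw [ndlRow_def]
  exact (Finset.abs_sum_le_sum_abs _ _).trans (le_of_eq (Finset.sum_congr rfl fun s _ => abs_mul _ _))

/-- [folklore] `x ↦ |ndlRow (x+e_ρ) − ndlRow x|` is summable over `ℤ⁴`. -/
theorem summable_abs_ndlRow_diff (ha : 0 < a) (ρ : Fin 4) :
    Summable fun x : X 4 => |ndlRow n a κ' u (x + unitVec ρ) - ndlRow n a κ' u x| :=
  Summable.of_nonneg_of_le (fun _ => abs_nonneg _) (fun _ => abs_sub _ _)
    (((summable_abs_ndlRow n κ' u ha).comp_injective (add_left_injective (unitVec ρ))).add (summable_abs_ndlRow n κ' u ha))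

/-- [folklore] **THE FINE MASS OF THE NEEDLE POTENTIAL** (an3 §3′ (2)∕(6) «`m_row(u) ≤ w_u·m_ρ`», «`m_row ≤ kK`» at κ′ = 3):
`Σ'_x |ndlRow n a κ′ u x| ≤ (n^{κ′+1}·n⁻⁴) · cR a · K₄(dR a)`. -/
theorem tsum_abs_ndlRow_le (ha : 0 < a) :
    ∑' x : X 4, |ndlRow n a κ' u x| ≤ ((n : ℝ) ^ ((κ' : ℕ) + 1) * ((n : ℝ) ^ 4)⁻¹) * (cR a * latticeConst 4 (dR a)) := by
  have hn : (0 : ℝ) < n := Nat.cast_pos.mpr (Nat.pos_of_ne_zero (NeZero.ne n))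
  rw [tsum_eq_tsum_blocks (n - 1) (summable_abs_ndlRow n κ' u ha), ← mul_assoc]
  refine (le_abs_self _).trans (abs_tsum_le_latticeConst (dR_pos ha) (mul_nonneg (by positivity) (cR_nonneg ha)) (blk (n - 1) u) fun β => ?_)
  rw [abs_of_nonneg (Finset.sum_nonneg fun x _ => abs_nonneg _), dist_comm, mul_assoc]
  exact sum_B_abs_ndlRow_le n κ' u ha β

/-- [folklore] **THE FINE MASS OF THE FIRST DIFFERENCE OF THE NEEDLE POTENTIAL** (an3 §3′ (2)∕(6) «`m′_row(u) ≤ w_u·m′_ρ`», «`m′_row ≤ kK∕n`» at κ′ = 3):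
`Σ'_x |ndlRow (x+e_ρ) − ndlRow x| ≤ (n^{κ′+1}·n⁻⁴) · (cRd a∕n) · K₄(dR a)`. -/
theorem tsum_abs_ndlRow_diff_le (ha : 0 < a) (ρ : Fin 4) :
    ∑' x : X 4, |ndlRow n a κ' u (x + unitVec ρ) - ndlRow n a κ' u x|
      ≤ ((n : ℝ) ^ ((κ' : ℕ) + 1) * ((n : ℝ) ^ 4)⁻¹) * (cRd a / n * latticeConst 4 (dR a)) := by
  have hn : (0 : ℝ) < n := Nat.cast_pos.mpr (Nat.pos_of_ne_zero (NeZero.ne n))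
  rw [tsum_eq_tsum_blocks (n - 1) (summable_abs_ndlRow_diff n κ' u ha ρ), ← mul_assoc]
  refine (le_abs_self _).trans (abs_tsum_le_latticeConst (dR_pos ha)
    (mul_nonneg (by positivity) (div_nonneg (cRd_nonneg ha) hn.le)) (blk (n - 1) u) fun β => ?_)
  rw [abs_of_nonneg (Finset.sum_nonneg fun x _ => abs_nonneg _), dist_comm, mul_assoc]
  exact sum_B_abs_ndlRow_diff_le n κ' u ha β ρ

end

end Summit.QuantumFields.BalabanUV.Beta.D1BFx.NeedlePotentialLetters
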